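import Summits.HodgeConjecture.CorCM.DihedralSexticPairCurveHodgeOfMarkmanSimple
import Summits.HodgeConjecture.CorCM.GaloisSexticPrimitivePairIsogenous
import HarnessLib

/-!
# COR-CM — the Hodge conjecture, modulo Markman's fourfold theorem, for `B₀ × B₁` and `E × B₀ × B₁`: two SIMPLE,
# NON-ISOGENOUS CM threefolds with CM by ONE sextic CM field `K ⊇ k` and a CM elliptic curve of `k` — final form,
# no hypothesis on `Gal(K/ℚ)`

Cell `pub-hodgecm2` (COR-CM), seat b30 gen 14 (2026-08-21); COUNT-NEUTRAL; theorems only, no definition, no named fact,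
no `sorry`.  The geometric theorems of `CorCM/DihedralSexticPairCurveHodgeOfMarkmanSimple.lean` assumed `K` NOT
Galois over `ℚ`; that hypothesis is REDUNDANT: over a Galois (hence cyclic) sextic CM field two simple CM threefolds
are Galois twists of each other and therefore isogenous (`CyclicSextic.isIsogenous_of_isGalois`,
`CorCM/GaloisSexticPrimitivePairIsogenous.lean`), contradicting `B₀ ≁ B₁` (`not_isGalois_of_isSimple_of_not_isIsogenous`).

MAIN THEOREMS (namespace `SexticCMThreefoldPair`), GIVEN ONLY `Markman2025_weilClasses_algebraic_abelianFourfold`: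
for `K` ANY CM field of degree `6`, `k` an imaginary quadratic field with `i : k →+* K`, `B₀ ⊨ (K; Φ₀)`,
`B₁ ⊨ (K; Φ₁)` SIMPLE abelian threefolds (`IsCMTypeRealisation`, `AbelianVariety.IsSimple`) that are NOT isogenous,
and `E ⊨ (k; Ψ)` a CM elliptic curve —
* `hodgeConjectureFor_biproduct_of_markman`: **HC for `B₀ × B₁ = ⨁_{j<2} A_j`**;
* `hodgeConjectureFor_biproduct_vec_of_markman`: **HC for `E × B₀ × B₁ = ⨁ ![E, B₀, B₁]`** (family form
  `…_curveSlots_…`);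
* `…_of_avDominatedBy_…`: HC for every abelian variety they dominate (all isogeny factors; NOT the powers).

(Such pairs exist only for `K` non-Galois, `K = k·F₀` with `F₀` a non-cyclic totally real cubic; the content is that of
the `Dihedral…` files.)  HONEST FRAMING: conditional on Markman's theorem only; `HC_CM` is not asserted.

## References
* [Markman2025SurveySecant] E. Markman, arXiv:2509.23403, Thm. 1.2 and §11.5 Step 2.
* [Shimura1998] §6.1 Cor., §8.2 Prop. 26, §8.4.  [Pohlmann1968] Ann. of Math. 88, Thm 1.  [GaoUllmo2025] Thm 3.1.
  [MoonenZarhin1999LowDim] Duke 98 (1999), Thm. 0.1.  [MumfordAV1970] §19.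
-/

noncomputable section

open CategoryTheory CategoryTheory.Limits NumberField

namespace Summit.HodgeConjecture.CorCM.SexticCMThreefoldPair

open Literature.AlgebraicGeometry Literature.AlgebraicGeometry.Motives Literature.AlgebraicGeometry.HodgeTheory
open Literature.AlgebraicGeometry.ComplexMultiplication (IsCMTypeRealisation)
open Summit.HodgeConjecture.CorCM.DihedralSexticPair (exists_mem_comp_ne_of_isSimple)

/-! ## §1 Two simple non-isogenous CM threefolds force `K` non-Galois -/

section NotGalois

variable {K : Type} [Field K] [NumberField K] [IsCMField K] {k : Type} [Field k] [NumberField k] [IsCMField k]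

/-- **If a sextic CM field `K ⊇ i(k)` carries two simple, non-isogenous CM threefolds, then `K/ℚ` is not Galois**:
over a Galois sextic CM field the types of two simple threefolds are not induced from `k`
(`exists_mem_comp_ne_of_isSimple`), hence Galois twists of each other, and the threefolds are isogenous
(`CyclicSextic.isIsogenous_of_isGalois`). [cite: Shimura1998, §6.1 Cor., §8.2 Prop. 26] -/
theorem not_isGalois_of_isSimple_of_not_isIsogenous (h6 : Module.finrank ℚ K = 6)
    (h2 : Module.finrank ℚ k = 2) (i : k →+* K) {Φ₀ Φ₁ : CMType K}
    {A₀ : AbelianVariety ℂ} {ι₀ : 𝓞 K →+* End A₀} {θ₀ : K →+* Module.End ℂ (complexBetti A₀.X 1)}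
    {A₁ : AbelianVariety ℂ} {ι₁ : 𝓞 K →+* End A₁} {θ₁ : K →+* Module.End ℂ (complexBetti A₁.X 1)}
    (hA₀ : IsCMTypeRealisation Φ₀ A₀ ι₀ θ₀) (hA₁ : IsCMTypeRealisation Φ₁ A₁ ι₁ θ₁)
    (hS₀ : A₀.IsSimple) (hS₁ : A₁.IsSimple) (hni : ¬ AbelianVariety.IsIsogenous A₀ A₁) : ¬ IsGalois ℚ K := by
  intro hG
  exact hni (CyclicSextic.isIsogenous_of_isGalois h6 h2 i hA₀ hA₁
    (exists_mem_comp_ne_of_isSimple h6 h2 i hA₀ hS₀) (exists_mem_comp_ne_of_isSimple h6 h2 i hA₁ hS₁))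

end NotGalois

/-! ## §2 `B₀ × B₁` -/

section Pair

variable {K : Type} [Field K] [NumberField K] [IsCMField K] {k : Type} [Field k] [NumberField k] [IsCMField k]
  {A : Fin 2 → AbelianVariety ℂ} {Φ : Fin 2 → CMType K} {ι : ∀ j, 𝓞 K →+* End (A j)}
  {θ : ∀ j, K →+* Module.End ℂ (complexBetti (A j).X 1)}

/-- **The Hodge conjecture for `B₀ × B₁` modulo Markman's fourfold theorem**: `K` a CM field of degree `6`, `k` an
imaginary quadratic field with `i : k →+* K`, `A_j ⊨ (K; Φ_j)` SIMPLE abelian threefolds, `A₀ ≁ A₁` — every rational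
`(p,p)`-class on `⨁_{j<2} A_j` is algebraic, GIVEN ONLY `Markman2025_weilClasses_algebraic_abelianFourfold`.
[cite: Markman2025SurveySecant, Thm. 1.2 and §11.5 Step 2] [cite: Shimura1998, §6.1 Cor., §8.2 Prop. 26]
[cite: Pohlmann1968, Thm 1] [cite: MoonenZarhin1999LowDim, Thm. 0.1] -/
theorem hodgeConjectureFor_biproduct_of_markman (hW4 : Markman2025_weilClasses_algebraic_abelianFourfold)
    (h6 : Module.finrank ℚ K = 6) (h2 : Module.finrank ℚ k = 2) (i : k →+* K)
    (hA : ∀ j, IsCMTypeRealisation (Φ j) (A j) (ι j) (θ j)) (hS : ∀ j, (A j).IsSimple)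
    (hni : ¬ AbelianVariety.IsIsogenous (A 0) (A 1)) :
    HodgeConjectureFor (⨁ A).dim (⨁ A).X :=
  DihedralSexticPair.hodgeConjectureFor_biproduct_of_isSimple_of_markman hW4 h6 h2 i
    (not_isGalois_of_isSimple_of_not_isIsogenous h6 h2 i (hA 0) (hA 1) (hS 0) (hS 1) hni) hA hS hni

/-- **The Hodge conjecture for every abelian variety dominated by `B₀ ⊕ B₁`** (its isogeny factors; NOT the powers),
modulo Markman. [cite: Markman2025SurveySecant, Thm. 1.2] [cite: MumfordAV1970, §19] -/
theorem hodgeConjectureFor_of_avDominatedBy_of_markman (hW4 : Markman2025_weilClasses_algebraic_abelianFourfold)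
    (h6 : Module.finrank ℚ K = 6) (h2 : Module.finrank ℚ k = 2) (i : k →+* K)
    (hA : ∀ j, IsCMTypeRealisation (Φ j) (A j) (ι j) (θ j)) (hS : ∀ j, (A j).IsSimple)
    (hni : ¬ AbelianVariety.IsIsogenous (A 0) (A 1))
    {B : AbelianVariety ℂ} (hB : Domination.AVDominatedBy B (⨁ A)) : HodgeConjectureFor B.dim B.X :=
  Domination.hodgeConjectureFor_of_avDominatedBy (hodgeConjectureFor_biproduct_of_markman hW4 h6 h2 i hA hS hni) hB

end Pair

/-! ## §3 `E × B₀ × B₁` -/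

section Family

variable {I : Type} {Kf : I → Type} [∀ i, Field (Kf i)] [∀ i, NumberField (Kf i)] [∀ i, IsCMField (Kf i)]
  {i₀ i₁ : I}
  {A₃ : Fin 3 → AbelianVariety ℂ} {Φ₃ : ∀ j : Fin 3, CMType (Kf (DihedralSexticPairCurve.curveSlots i₀ i₁ j))}
  {ι₃ : ∀ j, 𝓞 (Kf (DihedralSexticPairCurve.curveSlots i₀ i₁ j)) →+* End (A₃ j)}
  {θ₃ : ∀ j, Kf (DihedralSexticPairCurve.curveSlots i₀ i₁ j) →+* Module.End ℂ (complexBetti (A₃ j).X 1)}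

/-- **The Hodge conjecture for `E × B₀ × B₁ = ⨁ A₃` modulo Markman, family form** (slots
`DihedralSexticPairCurve.curveSlots i₀ i₁ = (i₀, i₁, i₁)`; `k = Kf i₀` quadratic, `K = Kf i₁` sextic, `A₃ 0` the CM
elliptic curve, `A₃ (m+1)` SIMPLE, `A₃ 1 ≁ A₃ 2`). [cite: Markman2025SurveySecant, Thm. 1.2]
[cite: Shimura1998, §6.1 Cor., §8.2 Prop. 26] [cite: Pohlmann1968, Thm 1] -/
theorem hodgeConjectureFor_biproduct_curveSlots_of_markman (hW4 : Markman2025_weilClasses_algebraic_abelianFourfold)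
    (h6 : Module.finrank ℚ (Kf i₁) = 6) (h2 : Module.finrank ℚ (Kf i₀) = 2) (i : Kf i₀ →+* Kf i₁)
    (hA : ∀ j, IsCMTypeRealisation (Φ₃ j) (A₃ j) (ι₃ j) (θ₃ j)) (hS : ∀ m : Fin 2, (A₃ m.succ).IsSimple)
    (hni : ¬ AbelianVariety.IsIsogenous (A₃ (Fin.succ 0)) (A₃ (Fin.succ 1))) :
    HodgeConjectureFor (⨁ A₃).dim (⨁ A₃).X :=
  DihedralSexticPairCurve.hodgeConjectureFor_biproduct_curveSlots_of_isSimple_of_markman hW4 h6 h2 i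
    (not_isGalois_of_isSimple_of_not_isIsogenous h6 h2 i (hA (Fin.succ 0)) (hA (Fin.succ 1)) (hS 0) (hS 1) hni)
    hA hS hni

/-- **The Hodge conjecture for every abelian variety dominated by `E × B₀ × B₁`**, family form, modulo Markman.
[cite: Markman2025SurveySecant, Thm. 1.2] [cite: MumfordAV1970, §19] -/
theorem hodgeConjectureFor_of_avDominatedBy_curveSlots_of_markman
    (hW4 : Markman2025_weilClasses_algebraic_abelianFourfold)
    (h6 : Module.finrank ℚ (Kf i₁) = 6) (h2 : Module.finrank ℚ (Kf i₀) = 2) (i : Kf i₀ →+* Kf i₁)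
    (hA : ∀ j, IsCMTypeRealisation (Φ₃ j) (A₃ j) (ι₃ j) (θ₃ j)) (hS : ∀ m : Fin 2, (A₃ m.succ).IsSimple)
    (hni : ¬ AbelianVariety.IsIsogenous (A₃ (Fin.succ 0)) (A₃ (Fin.succ 1)))
    {B : AbelianVariety ℂ} (hB : Domination.AVDominatedBy B (⨁ A₃)) : HodgeConjectureFor B.dim B.X :=
  Domination.hodgeConjectureFor_of_avDominatedBy
    (hodgeConjectureFor_biproduct_curveSlots_of_markman hW4 h6 h2 i hA hS hni) hB

end Family

section Vec

variable {k K : Type} [Field k] [NumberField k] [IsCMField k] [Field K] [NumberField K] [IsCMField K]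
  {E : AbelianVariety ℂ} {Ψ : CMType k} {ιE : 𝓞 k →+* End E} {θE : k →+* Module.End ℂ (complexBetti E.X 1)}
  {B₀ B₁ : AbelianVariety ℂ} {Φ₀ Φ₁ : CMType K} {ι₀ : 𝓞 K →+* End B₀} {ι₁ : 𝓞 K →+* End B₁}
  {θ₀ : K →+* Module.End ℂ (complexBetti B₀.X 1)} {θ₁ : K →+* Module.End ℂ (complexBetti B₁.X 1)}

/-- **MAIN THEOREM.  The Hodge conjecture for `E × B₀ × B₁ = ⨁ ![E, B₀, B₁]` modulo Markman's fourfold theorem**: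
`K` a CM field of degree `6`, `k` an imaginary quadratic field with `i : k →+* K`, `E ⊨ (k; Ψ)` a CM elliptic curve,
`B₀ ⊨ (K; Φ₀)`, `B₁ ⊨ (K; Φ₁)` SIMPLE abelian threefolds that are NOT isogenous — every rational `(p,p)`-class on the
abelian sevenfold `⨁ ![E, B₀, B₁]` is algebraic, for every `p`, GIVEN ONLY
`Markman2025_weilClasses_algebraic_abelianFourfold`. [cite: Markman2025SurveySecant, Thm. 1.2 and §11.5 Step 2]
[cite: Shimura1998, §6.1 Cor., §8.2 Prop. 26, §8.4] [cite: Pohlmann1968, Thm 1] [cite: GaoUllmo2025, Thm 3.1]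
[cite: MoonenZarhin1999LowDim, Thm. 0.1] -/
theorem hodgeConjectureFor_biproduct_vec_of_markman (hW4 : Markman2025_weilClasses_algebraic_abelianFourfold)
    (h6 : Module.finrank ℚ K = 6) (h2 : Module.finrank ℚ k = 2) (i : k →+* K)
    (hE : IsCMTypeRealisation Ψ E ιE θE) (hB₀ : IsCMTypeRealisation Φ₀ B₀ ι₀ θ₀)
    (hB₁ : IsCMTypeRealisation Φ₁ B₁ ι₁ θ₁) (hS₀ : B₀.IsSimple) (hS₁ : B₁.IsSimple)
    (hni : ¬ AbelianVariety.IsIsogenous B₀ B₁) :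
    HodgeConjectureFor (⨁ (![E, B₀, B₁] : Fin 3 → AbelianVariety ℂ)).dim
      (⨁ (![E, B₀, B₁] : Fin 3 → AbelianVariety ℂ)).X :=
  DihedralSexticPairCurve.hodgeConjectureFor_biproduct_vec_of_isSimple_of_markman hW4 h6 h2 i
    (not_isGalois_of_isSimple_of_not_isIsogenous h6 h2 i hB₀ hB₁ hS₀ hS₁ hni) hE hB₀ hB₁ hS₀ hS₁ hni

/-- **The Hodge conjecture for every abelian variety dominated by `⨁ ![E, B₀, B₁]`** — `E × B₀ × B₁` in any
bracketing, `B_m × E`, `B₀ × B₁`, `B_m`, `E` (NOT the powers) — modulo Markman.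
[cite: Markman2025SurveySecant, Thm. 1.2] [cite: MumfordAV1970, §19] -/
theorem hodgeConjectureFor_of_avDominatedBy_vec_of_markman
    (hW4 : Markman2025_weilClasses_algebraic_abelianFourfold)
    (h6 : Module.finrank ℚ K = 6) (h2 : Module.finrank ℚ k = 2) (i : k →+* K)
    (hE : IsCMTypeRealisation Ψ E ιE θE) (hB₀ : IsCMTypeRealisation Φ₀ B₀ ι₀ θ₀)
    (hB₁ : IsCMTypeRealisation Φ₁ B₁ ι₁ θ₁) (hS₀ : B₀.IsSimple) (hS₁ : B₁.IsSimple)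
    (hni : ¬ AbelianVariety.IsIsogenous B₀ B₁)
    {B : AbelianVariety ℂ} (hB : Domination.AVDominatedBy B (⨁ (![E, B₀, B₁] : Fin 3 → AbelianVariety ℂ))) :
    HodgeConjectureFor B.dim B.X :=
  Domination.hodgeConjectureFor_of_avDominatedBy
    (hodgeConjectureFor_biproduct_vec_of_markman hW4 h6 h2 i hE hB₀ hB₁ hS₀ hS₁ hni) hB

end Vec

end Summit.HodgeConjecture.CorCM.SexticCMThreefoldPair

end
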